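import Summits.ResolutionOfSingularities.ResolutionOfSingularities.Theorems.FrobeniusClosingSteerSigmaTopLegalityOddDivisor
import Literature.AlgebraicGeometry.Resolution.ExcellentRings
import Literature.AlgebraicGeometry.Resolution.QuadraticTransforms
import HarnessLib

/-!
# [OURS · L0 W4.1] K3 WINDOW WORDS: the per-level lift package `LevelLift` and residual rationality `IsResiduallyRational`
# (chain W4.1 `FrobeniusClosingSteer`, crux stmt-ResolutionOfSingularities-16345; K3 route (R1), res-L0-w41-plan-1 RULINGs 250(a)/258;
# interface of record `D/res-D-lib-1/K3WindowInterface.lean` 1dc250035b4b213c; `--supports … --as helper`)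

HONEST FRAMING. OURS words (HIRONAKA-L librarian res-D-lib-1 gen 7), typed ONCE so that K3-a part 4 (`…SteerEtaleWindowLift`, lib-1: PROVES
`exists_rational_window_lift`), K3-b (`…SteerQuadraticTransformEtaleLift`, res-D-pv-040: CONSUMES `LevelLift` at two levels) and K3-d
(`…SteerWindowBaseChange`, lib-1) share one vocabulary. `LevelLift S S′ φ θ` packages what the étale residue enlargement `S ↦ S′ ≅ (S[X]/(P))_𝔫`
(`…SteerEtaleResidueLift`) delivers at ONE level of the window, read inside an ambient field `L′ ⊇ S′`: `φ` local, UNRAMIFIED `𝔪_S S′ = 𝔪_{S′}`, faithfully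
flat in descent form, `S′` generated by `φ(S)` and `θ` up to units of `S′`, and the transfers regular / dimension / excellent / perfect residue field /
isolated radicand germ (the last = res-D-pv-040's K3-c `IsolatedEtaleLift.hasIsolatedSingularity_radicand_of_etale_localization`). Definitions only; no
theorem, no instance, no notation. Nothing here is a statement of H. Hironaka's manuscript [Hironaka2017]. AI-written; AI review is weaker than expert review.
-/

set_option linter.dupNamespace false

namespace Summit.ResolutionOfSingularities.ResolutionOfSingularities.Theorems.SwitchingDichotomy.EtaleLift

open IsLocalRing Literature.AlgebraicGeometry.Resolution
open Summit.ResolutionOfSingularities.ResolutionOfSingularities.Theorems.SwitchingDichotomy.SigmaTopLegality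

/-- **One level of the K3 base change.** For a local subring `S ⊆ L`, a local subring `S′ ⊆ L′`, a ring map `φ : S → S′` and an element `θ ∈ L′`:
`φ` is a local homomorphism; `𝔪_S S′ = 𝔪_{S′}` (unramified); `φ⁻¹(I S′) = I` for every ideal (faithful flatness, descent form); `θ ∈ S′`; every `z ∈ S′` is
`u / v` with `u, v` in the subring generated by `φ(S)` and `θ` and `v` a unit of `S′`; and `S′` inherits regularity, Krull dimension, excellence, perfectness
of the residue field and isolatedness of every `2`-radicand germ from `S`. [invented: ours] -/
def LevelLift {L L' : Type} [Field L] [Field L'] (S : Subring L) [IsLocalRing S] (S' : Subring L') [IsLocalRing S']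
    (φ : S →+* S') (θ : L') : Prop :=
  IsLocalHom φ ∧
  (maximalIdeal S).map φ = maximalIdeal S' ∧
  (∀ I : Ideal S, (I.map φ).comap φ = I) ∧
  θ ∈ S' ∧
  (∀ z ∈ S', ∃ u ∈ Subring.closure (Set.range (fun s : S => ((φ s : S') : L')) ∪ {θ}),
    ∃ v ∈ Subring.closure (Set.range (fun s : S => ((φ s : S') : L')) ∪ {θ}), v⁻¹ ∈ S' ∧ z = u / v) ∧
  (IsRegularLocalRing S → IsRegularLocalRing S') ∧
  ringKrullDim S' = ringKrullDim S ∧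
  (IsExcellentRing S → IsExcellentRing S') ∧
  (PerfectField (ResidueField S) → PerfectField (ResidueField S')) ∧
  (∀ f : S, HasIsolatedSingularity (RadicandRing S 2 f) → HasIsolatedSingularity (RadicandRing S' 2 (φ f)))

/-- **Residual rationality** of an inclusion `A ≤ B` of local subrings of a field: every element of `B` is congruent modulo `𝔪_B` to an element of `A`
(the binder shape `hrat` of `NoSatelliteStep.span_excParam_eq_of_rational`). [invented: ours] -/
def IsResiduallyRational {L' : Type} [Field L'] (A B : Subring L') [IsLocalRing A] [IsLocalRing B] (h : A ≤ B) : Prop :=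
  ∀ z : B, ∃ s : A, z - Subring.inclusion h s ∈ maximalIdeal B

end Summit.ResolutionOfSingularities.ResolutionOfSingularities.Theorems.SwitchingDichotomy.EtaleLift
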